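import Summits.BirchSwinnertonDyer.BirchSwinnertonDyer.Theses.DefiniteTheta

/-!
# Birth skeleton (BC3) for crux `DerivedHeightCap` — route `DefiniteTheta`, item stmt-BirchSwinnertonDyer-18438

Crux (FIXED; the route's decl `Summit.BirchSwinnertonDyer.BirchSwinnertonDyer.Theses.DefiniteTheta.DerivedHeightCap`):
at EVERY admissible definite datum `(V, p, N⁺, N⁻, K, S, T, φ)` (elliptic globally minimal `V/ℚ`; `p ≥ 7` good
ordinary with `a_p ≢ 0, ±1 (mod p)`, `ρ̄_{V,p}` surjective, `p ∤ q² − 1` for `q ∣ N`, `p ∤ h_K`; `K` imaginary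
quadratic, `d_K < −4`, `(d_K, N p) = 1`; `N = N⁺N⁻` coprime, `N⁻` with an odd number of prime factors, all inert,
primes of `N⁺` split; `S` a Brandt setup of type `(N⁺, N⁻)`, `T` a tower of Gross points of conductor `p^n`, `φ` a
generator of the `a(V)`-eigen-line of the Brandt module):
`(corank_{ℤ_p} Sel_{p^∞}(V/ℚ) : ℕ∞) ≤ ord_J θ_∞^{ac}` (`GrossPointTower.acOrderOfVanishing` at the unit root `α_p`).

## The line (the route header's TWO-LAYER PLAN for this crux: SqCap → NormCompatible → TowerSqrt)

Write `θ_n := T.thetaAc p φ α n ∈ ℤ_p[G_{n+1}^{ac}]` (`G^{ac} = Pic(𝒪_{p^{n+1}}) / im Δ`, the finite layers of the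
anticyclotomic `ℤ_p`-extension, BD05 §1.2), `θ_n^* := ι(θ_n)` its image under the involution `ι : σ ↦ σ⁻¹`
(`MonoidAlgebra.mapDomain (fun σ => σ⁻¹)`, which is the ring automorphism `mapDomainRingHom ℤ_[p] invMonoidHom`), `I = augIdeal`, `s := corank_{ℤ_p} Sel_{p^∞}(V/ℚ)`.

* `stub_lpCap` (LOAD-BEARING, literature-adjacent; the header's "SqCap" stated faithfully for the anticyclotomic
  `p`-adic `L`-function `L_p(E, K) = θ θ^*` (BD96 §2.7, BD05 §1.2) rather than for `θ²`; size XL): for every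
  admissible datum and every level, `θ_n · θ_n^* ∈ I^{2s}`. Intended proof (card K2): Chida–Hsieh 2015 Thm 1
  (arXiv:1304.3311; after BD05 Thm 1, Pollack–Weston 2011, Vatsal μ = 0): `char_Λ Sel(K_∞, E[p^∞])^∨ ∣ L_p(E, K)`
  in `Λ = ℤ_p⟦G_∞^{ac}⟧`; Greenberg control (LNM 1716) : `rank_{ℤ_p} X/JX = corank Sel_{p^∞}(E/K) = s⁺ + s⁻` with
  `s⁺ = s`, `s⁻ = corank Sel_{p^∞}(E^{K}/ℚ)`; the Bertolini–Darmon derived-height parity bound (BD95 / Howard 2004;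
  BD05 Cor. 3: `ord_{s=1} L_p(E, K, s) ≥ 2·max(s⁺, s⁻)`): `ord_J char X ≥ 2·max(s⁺, s⁻) ≥ 2s`; ideals of `Λ` are
  closed, so `L_p ∈ J^{2s}` is `θ_n θ_n^* ∈ I_n^{2s}` at every finite layer. The hypotheses are EXACTLY the crux's
  (CH15 (CR⁺) is vacuous under `p ∤ q² − 1`; (PO) is `p ∤ a_p² − 1`; `p ≥ 7`).
  Why it might fail: the crux's own caveats (non-squarefree `N⁺` is outside the tree's tower facts; the identification
  of the tree's finite-level `θ_n^{ac}` with CH15's `L_p` up to `Λˣ` and `ι`).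
* `stub_normCompatible` (BD96 Prop. 2.7 / Cor. 2.8 in the datum's generality; size M–L): at every admissible datum the
  theta elements of the tower are norm-compatible at the unit root, `T.IsNormCompatible p φ α_p`. For square-free
  `N` this is the named fact `Literature.NumberTheory.EllipticCurves.grossPointTower_isNormCompatible` once
  (i) `φ` spanning the eigen-lattice is shown to be a `T(p)`-eigenvector with eigenvalue `a_p = V.LFunction p`,
  (ii) `padicUnitRoot_spec` is fed the unit root that Hensel's lemma produces from `p ∤ a_p` (`padicUnitRoot` is junk
  `1` otherwise), (iii) `IsImaginaryQuadratic K` is read off `finrank = 2 ∧ IsTotallyComplex`; the datum also allows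
  `q² ∣ N⁺`, where BD96 §2.4–2.7 still applies but the tree's fact does not (prover-side extension, or prove Prop. 2.7
  from the norm relations of `GrossPointsPicardAction`). Why it might fail: only through that non-squarefree corner.
* `stub_towerSqrt` (pure Iwasawa-algebra, no arithmetic; size M–L): for ANY number field `K`, prime `p`, setup, tower,
  `φ`, `α` with `(θ_n)_n` norm-compatible: if `θ_n θ_n^* ∈ I_n^{2ρ}` for all `n` then `θ_n ∈ I_n^{ρ}` for all `n`
  (`T.VanishesToOrderAc p φ α ρ`). Proof idea: norm-compatibility descends to the anticyclotomic layers
  (`picRes` maps `torsionImage` into `torsionImage`), `lim_n ℤ_p[G_{n+1}^{ac}] ≅ ℤ_p⟦T₁,…,T_d⟧ =: Λ` (`d = 1` for `K`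
  imaginary quadratic; `d = 0`, Λ = ℤ_p, for `K` real quadratic or `ℚ`), membership in `I_n^{k}` at all layers ⟺
  membership in the closed ideal `𝔞^{k}`, `𝔞 = (T₁,…,T_d)` (ideals of the compact Noetherian ring `Λ` are closed and
  `ker(Λ → ℤ_p[G_n^{ac}]) → 0`); `gr_𝔞 Λ` is a domain so `ord_𝔞(uv) = ord_𝔞 u + ord_𝔞 v`, and `ι` is a ring
  automorphism preserving `𝔞`, so `ord_𝔞 θ^* = ord_𝔞 θ`; hence `2·ord_𝔞 θ ≥ 2ρ`. FALSE at a single finite layer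
  without norm-compatibility (`ℤ_p[ℤ/p^k]` is not a domain), which is why `IsNormCompatible` is a hypothesis and
  `stub_normCompatible` a separate stub. Why it might fail: it should not (it is a theorem of commutative algebra);
  the Lean cost is the missing identification `Λ ≅ lim ℤ_p[G_n^{ac}]` (route DEFINITION REQUEST D2).

`DerivedHeightCap_of_stubs` composes the three STATEMENTS (real proof: instantiate `stub_towerSqrt` at
`α := α_p`, `ρ := s`, feed it `stub_normCompatible` and `stub_lpCap`, finish with
`GrossPointTower.le_acOrderOfVanishing`); its conclusion is the crux body verbatim, and
`DerivedHeightCap_of : DefiniteTheta.DerivedHeightCap` is the closed registrar-shape theorem concluding the crux BY NAME.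

`sorry` occurs ONLY in the three `stub_*` theorems (three sorries = three stubs); nowhere else.
-/

namespace Summit.BirchSwinnertonDyer.BirchSwinnertonDyer.Cruxes.DerivedHeightCap.Birth

/-- STUB 1 (card K2; LOAD-BEARING, literature-adjacent; size XL). `L_p`-CAP AT FINITE LAYERS. For every admissible
definite datum (the crux's hypotheses verbatim) and every `n`: `θ_n · ι(θ_n) ∈ I^{2·corank Sel_{p^∞}(V/ℚ)}` in
`ℤ_p[G_{n+1}^{ac}]`, where `θ_n = T.thetaAc p φ α_p n`, `ι : σ ↦ σ⁻¹`, `I` the augmentation ideal — the finite-layer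
form of `L_p(E, K) = θ θ^* ∈ J^{2s}` (Chida–Hsieh 2015 Thm 1 divisibility `char X ∣ L_p` + Greenberg control +
the derived-height parity bound `ord_J char X ≥ 2·max(s⁺, s⁻)`, BD05 Cor. 3 / BD95 / Howard 2004).
Why it might fail: non-squarefree `N⁺` (allowed by the datum) is outside the tree's tower facts; the comparison of the
tree's `θ_n^{ac}` with CH15's `L_p` is up to `Λˣ` and `ι` only. Sources: ChidaHsieh2013 (arXiv:1304.3311) Thm 1,
BertoliniDarmon2005 Thm 1 and Cor. 3, GreenbergLNM1716, Howard2004DerivedHeights, PollackWeston2011, Vatsal2003. -/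
theorem stub_lpCap :
    ∀ (V : WeierstrassCurve ℚ) [V.IsElliptic] [V.IsGloballyMinimal] (p : ℕ) [Fact p.Prime] (Nplus Nminus : ℕ) (K : Type) [Field K] [NumberField K] (S : Literature.NumberTheory.Automorphic.Brandt.XiSetup Nplus Nminus) [Fintype (Literature.NumberTheory.Automorphic.Brandt.ClassSet S.O)] (T : Literature.NumberTheory.EllipticCurves.GrossPointTower K S p) (φ : Literature.NumberTheory.Automorphic.Brandt.ClassSet S.O → ℤ), ((7 ≤ p ∧ V.HasGoodReductionAtPrime p ∧ ¬ (p : ℤ) ∣ V.frobeniusTrace p ∧ ¬ (p : ℤ) ∣ (V.frobeniusTrace p) ^ 2 - 1 ∧ V.HasSurjectiveModNGaloisRep p ∧ (∀ q : ℕ, q.Prime → q ∣ V.conductorNorm ℤ → ¬ (p : ℤ) ∣ (q : ℤ) ^ 2 - 1) ∧ ¬ p ∣ NumberField.classNumber K) ∧ (Module.finrank ℚ K = 2 ∧ NumberField.IsTotallyComplex K ∧ NumberField.discr K < -4 ∧ Int.gcd (NumberField.discr K) (V.conductorNorm ℤ * p) = 1) ∧ (V.conductorNorm ℤ = Nplus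 * Nminus ∧ Nat.Coprime Nplus Nminus ∧ Odd Nminus.primeFactors.card ∧ (∀ q : ℕ, q.Prime → q ∣ Nplus → ((Ideal.span {(q : ℤ)}).primesOver (NumberField.RingOfIntegers K)).ncard = 2) ∧ (∀ q : ℕ, q.Prime → q ∣ Nminus → ((Ideal.span {(q : ℤ)}).primesOver (NumberField.RingOfIntegers K)).ncard = 1)) ∧ (φ ≠ 0 ∧ Literature.NumberTheory.Automorphic.Brandt.eigenLattice (Nplus * Nminus) (Literature.NumberTheory.Automorphic.Brandt.matrix S.O) (fun n => V.LFunction n) = Submodule.span ℤ {φ})) → ∀ n : ℕ, T.thetaAc p φ (Literature.NumberTheory.EllipticCurves.padicUnitRoot p (V.LFunction p)) n * MonoidAlgebra.mapDomain (fun σ => σ⁻¹) (T.thetaAc p φ (Literature.NumberTheory.EllipticCurves.padicUnitRoot p (V.LFunction p)) n) ∈ Literature.NumberTheory.EllipticCurves.augIdeal ℤ_[p] (Literature.NumberTheory.EllipticCurves.AcLayerGroup K p (n + 1)) ^ (2 * V.selmerCorank p) := by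
  sorry

/-- STUB 2 (BD96 Prop. 2.7 / Cor. 2.8 in the datum's generality; size M–L). NORM-COMPATIBILITY AT THE UNIT ROOT.
For every admissible definite datum the theta elements `θ_{n+1}(V, K)` of the tower are compatible under
`ℤ_p[G_{n+2}] → ℤ_p[G_{n+1}]`, i.e. `θ_∞` exists. For square-free `N` this is the named fact
`Literature.NumberTheory.EllipticCurves.grossPointTower_isNormCompatible` after (i) `T(p) φ = a_p φ` from
`eigenLattice … = ℤ ∙ φ`, (ii) existence of the unit root of `x² − a_p x + p` from `p ∤ a_p` (Hensel) so that
`padicUnitRoot_spec` applies, (iii) `IsImaginaryQuadratic K` from `finrank ℚ K = 2 ∧ IsTotallyComplex K`.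
Why it might fail: the datum allows `q² ∣ N⁺`, not covered by the tree's fact (BD96 §2.4–2.7 still apply).
Sources: BertoliniDarmon1996 Prop. 2.7, Cor. 2.8; `grossPointTower_isNormCompatible`. -/
theorem stub_normCompatible :
    ∀ (V : WeierstrassCurve ℚ) [V.IsElliptic] [V.IsGloballyMinimal] (p : ℕ) [Fact p.Prime] (Nplus Nminus : ℕ) (K : Type) [Field K] [NumberField K] (S : Literature.NumberTheory.Automorphic.Brandt.XiSetup Nplus Nminus) [Fintype (Literature.NumberTheory.Automorphic.Brandt.ClassSet S.O)] (T : Literature.NumberTheory.EllipticCurves.GrossPointTower K S p) (φ : Literature.NumberTheory.Automorphic.Brandt.ClassSet S.O → ℤ), ((7 ≤ p ∧ V.HasGoodReductionAtPrime p ∧ ¬ (p : ℤ) ∣ V.frobeniusTrace p ∧ ¬ (p : ℤ) ∣ (V.frobeniusTrace p) ^ 2 - 1 ∧ V.HasSurjectiveModNGaloisRep p ∧ (∀ q : ℕ, q.Prime → q ∣ V.conductorNorm ℤ → ¬ (p : ℤ) ∣ (q : ℤ) ^ 2 - 1) ∧ ¬ p ∣ NumberField.classNumber K) ∧ (Module.finrank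 ℚ K = 2 ∧ NumberField.IsTotallyComplex K ∧ NumberField.discr K < -4 ∧ Int.gcd (NumberField.discr K) (V.conductorNorm ℤ * p) = 1) ∧ (V.conductorNorm ℤ = Nplus * Nminus ∧ Nat.Coprime Nplus Nminus ∧ Odd Nminus.primeFactors.card ∧ (∀ q : ℕ, q.Prime → q ∣ Nplus → ((Ideal.span {(q : ℤ)}).primesOver (NumberField.RingOfIntegers K)).ncard = 2) ∧ (∀ q : ℕ, q.Prime → q ∣ Nminus → ((Ideal.span {(q : ℤ)}).primesOver (NumberField.RingOfIntegers K)).ncard = 1)) ∧ (φ ≠ 0 ∧ Literature.NumberTheory.Automorphic.Brandt.eigenLattice (Nplus * Nminus) (Literature.NumberTheory.Automorphic.Brandt.matrix S.O) (fun n => V.LFunction n) = Submodule.span ℤ {φ})) → T.IsNormCompatible p φ (Literature.NumberTheory.EllipticCurves.padicUnitRoot p (V.LFunction p)) := by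
  sorry

/-- STUB 3 (pure Iwasawa algebra; size M–L). SQUARE ROOT ALONG THE TOWER. For any number field `K`, prime `p`,
Brandt setup `S`, tower `T`, weights `φ` and unit `α` with `(θ_n)_n` norm-compatible: if `θ_n · ι(θ_n) ∈ I_n^{2ρ}`
in `ℤ_p[G_{n+1}^{ac}]` for every `n`, then `θ_n ∈ I_n^{ρ}` for every `n` (`VanishesToOrderAc ρ`). In
`Λ = lim_n ℤ_p[G_n^{ac}] ≅ ℤ_p⟦T₁,…,T_d⟧` membership at all finite layers is membership in the closed ideal `𝔞^k`,
`gr_𝔞 Λ` is a domain (`ord_𝔞` is additive) and `ι` preserves `ord_𝔞`. False at one finite layer without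
norm-compatibility. Sources: BertoliniDarmon2005 §1.2 (`G_∞ = G̃_∞/Δ ≃ ℤ_p`, `Λ`); Washington, Cyclotomic Fields
§7.1 and §13.2 (`ℤ_p⟦ℤ_p⟧ ≅ ℤ_p⟦T⟧`, closed ideals); NeukirchSchmidtWingberg (5.3.5). -/
theorem stub_towerSqrt :
    ∀ (K : Type) [Field K] [NumberField K] (p : ℕ) [Fact p.Prime] (Nplus Nminus : ℕ) (S : Literature.NumberTheory.Automorphic.Brandt.XiSetup Nplus Nminus) (T : Literature.NumberTheory.EllipticCurves.GrossPointTower K S p) (φ : Literature.NumberTheory.Automorphic.Brandt.ClassSet S.O → ℤ) (α : ℤ_[p]ˣ), T.IsNormCompatible p φ α → ∀ ρ : ℕ, (∀ n : ℕ, T.thetaAc p φ α n * MonoidAlgebra.mapDomain (fun σ => σ⁻¹) (T.thetaAc p φ α n) ∈ Literature.NumberTheory.EllipticCurves.augIdeal ℤ_[p] (Literature.NumberTheory.EllipticCurves.AcLayerGroup K p (n + 1)) ^ (2 * ρ)) → T.VanishesToOrderAc p φ α ρ := by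
  sorry

/-! ## Assembly (sorry-free) -/

/-- ASSEMBLY (kernel-checked, real proof): the three stub STATEMENTS (hypotheses `h1 h2 h3`, verbatim the types of
`stub_lpCap`, `stub_normCompatible`, `stub_towerSqrt`) imply the crux statement (verbatim the body of
`DefiniteTheta.DerivedHeightCap`; `DerivedHeightCap_of` below concludes it BY NAME). Given the datum, `h2` gives
norm-compatibility at `α_p`, `h1` gives `θ_n ι(θ_n) ∈ I^{2s}` at every layer (`s = corank Sel_{p^∞}(V/ℚ)`), `h3`
turns the two into `VanishesToOrderAc s`, and `GrossPointTower.le_acOrderOfVanishing` gives `(s : ℕ∞) ≤ ord_J θ^{ac}`. -/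
theorem DerivedHeightCap_of_stubs
    (h1 : ∀ (V : WeierstrassCurve ℚ) [V.IsElliptic] [V.IsGloballyMinimal] (p : ℕ) [Fact p.Prime] (Nplus Nminus : ℕ) (K : Type) [Field K] [NumberField K] (S : Literature.NumberTheory.Automorphic.Brandt.XiSetup Nplus Nminus) [Fintype (Literature.NumberTheory.Automorphic.Brandt.ClassSet S.O)] (T : Literature.NumberTheory.EllipticCurves.GrossPointTower K S p) (φ : Literature.NumberTheory.Automorphic.Brandt.ClassSet S.O → ℤ), ((7 ≤ p ∧ V.HasGoodReductionAtPrime p ∧ ¬ (p : ℤ) ∣ V.frobeniusTrace p ∧ ¬ (p : ℤ) ∣ (V.frobeniusTrace p) ^ 2 - 1 ∧ V.HasSurjectiveModNGaloisRep p ∧ (∀ q : ℕ, q.Prime → q ∣ V.conductorNorm ℤ → ¬ (p : ℤ) ∣ (q : ℤ) ^ 2 - 1) ∧ ¬ p ∣ NumberField.classNumber K) ∧ (Module.finrank ℚ K = 2 ∧ NumberField.IsTotallyComplex K ∧ NumberField.discr K < -4 ∧ Int.gcd (NumberField.discr K) (V.conductorNorm ℤ * p) = 1) ∧ (V.conductorNorm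 ℤ = Nplus * Nminus ∧ Nat.Coprime Nplus Nminus ∧ Odd Nminus.primeFactors.card ∧ (∀ q : ℕ, q.Prime → q ∣ Nplus → ((Ideal.span {(q : ℤ)}).primesOver (NumberField.RingOfIntegers K)).ncard = 2) ∧ (∀ q : ℕ, q.Prime → q ∣ Nminus → ((Ideal.span {(q : ℤ)}).primesOver (NumberField.RingOfIntegers K)).ncard = 1)) ∧ (φ ≠ 0 ∧ Literature.NumberTheory.Automorphic.Brandt.eigenLattice (Nplus * Nminus) (Literature.NumberTheory.Automorphic.Brandt.matrix S.O) (fun n => V.LFunction n) = Submodule.span ℤ {φ})) → ∀ n : ℕ, T.thetaAc p φ (Literature.NumberTheory.EllipticCurves.padicUnitRoot p (V.LFunction p)) n * MonoidAlgebra.mapDomain (fun σ => σ⁻¹) (T.thetaAc p φ (Literature.NumberTheory.EllipticCurves.padicUnitRoot p (V.LFunction p)) n) ∈ Literature.NumberTheory.EllipticCurves.augIdeal ℤ_[p] (Literature.NumberTheory.EllipticCurves.AcLayerGroup K p (n + 1)) ^ (2 * V.selmerCorank p))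
    (h2 : ∀ (V : WeierstrassCurve ℚ) [V.IsElliptic] [V.IsGloballyMinimal] (p : ℕ) [Fact p.Prime] (Nplus Nminus : ℕ) (K : Type) [Field K] [NumberField K] (S : Literature.NumberTheory.Automorphic.Brandt.XiSetup Nplus Nminus) [Fintype (Literature.NumberTheory.Automorphic.Brandt.ClassSet S.O)] (T : Literature.NumberTheory.EllipticCurves.GrossPointTower K S p) (φ : Literature.NumberTheory.Automorphic.Brandt.ClassSet S.O → ℤ), ((7 ≤ p ∧ V.HasGoodReductionAtPrime p ∧ ¬ (p : ℤ) ∣ V.frobeniusTrace p ∧ ¬ (p : ℤ) ∣ (V.frobeniusTrace p) ^ 2 - 1 ∧ V.HasSurjectiveModNGaloisRep p ∧ (∀ q : ℕ, q.Prime → q ∣ V.conductorNorm ℤ → ¬ (p : ℤ) ∣ (q : ℤ) ^ 2 - 1) ∧ ¬ p ∣ NumberField.classNumber K) ∧ (Module.finrank ℚ K = 2 ∧ NumberField.IsTotallyComplex K ∧ NumberField.discr K < -4 ∧ Int.gcd (NumberField.discr K) (V.conductorNorm ℤ * p) = 1) ∧ (V.conductorNorm ℤ = Nplus * Nminus ∧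 Nat.Coprime Nplus Nminus ∧ Odd Nminus.primeFactors.card ∧ (∀ q : ℕ, q.Prime → q ∣ Nplus → ((Ideal.span {(q : ℤ)}).primesOver (NumberField.RingOfIntegers K)).ncard = 2) ∧ (∀ q : ℕ, q.Prime → q ∣ Nminus → ((Ideal.span {(q : ℤ)}).primesOver (NumberField.RingOfIntegers K)).ncard = 1)) ∧ (φ ≠ 0 ∧ Literature.NumberTheory.Automorphic.Brandt.eigenLattice (Nplus * Nminus) (Literature.NumberTheory.Automorphic.Brandt.matrix S.O) (fun n => V.LFunction n) = Submodule.span ℤ {φ})) → T.IsNormCompatible p φ (Literature.NumberTheory.EllipticCurves.padicUnitRoot p (V.LFunction p)))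
    (h3 : ∀ (K : Type) [Field K] [NumberField K] (p : ℕ) [Fact p.Prime] (Nplus Nminus : ℕ) (S : Literature.NumberTheory.Automorphic.Brandt.XiSetup Nplus Nminus) (T : Literature.NumberTheory.EllipticCurves.GrossPointTower K S p) (φ : Literature.NumberTheory.Automorphic.Brandt.ClassSet S.O → ℤ) (α : ℤ_[p]ˣ), T.IsNormCompatible p φ α → ∀ ρ : ℕ, (∀ n : ℕ, T.thetaAc p φ α n * MonoidAlgebra.mapDomain (fun σ => σ⁻¹) (T.thetaAc p φ α n) ∈ Literature.NumberTheory.EllipticCurves.augIdeal ℤ_[p] (Literature.NumberTheory.EllipticCurves.AcLayerGroup K p (n + 1)) ^ (2 * ρ)) → T.VanishesToOrderAc p φ α ρ) :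
    -- the body of `DefiniteTheta.DerivedHeightCap`, verbatim (the closed theorem `DerivedHeightCap_of` below
    -- restates it BY NAME; kept unfolded here so that the registrar sees exactly one theorem concluding the crux)
    ∀ (V : WeierstrassCurve ℚ) [V.IsElliptic] [V.IsGloballyMinimal] (p : ℕ) [Fact p.Prime] (Nplus Nminus : ℕ) (K : Type) [Field K] [NumberField K] (S : Literature.NumberTheory.Automorphic.Brandt.XiSetup Nplus Nminus) [Fintype (Literature.NumberTheory.Automorphic.Brandt.ClassSet S.O)] (T : Literature.NumberTheory.EllipticCurves.GrossPointTower K S p) (φ : Literature.NumberTheory.Automorphic.Brandt.ClassSet S.O → ℤ), ((7 ≤ p ∧ V.HasGoodReductionAtPrime p ∧ ¬ (p : ℤ) ∣ V.frobeniusTrace p ∧ ¬ (p : ℤ) ∣ (V.frobeniusTrace p) ^ 2 - 1 ∧ V.HasSurjectiveModNGaloisRep p ∧ (∀ q : ℕ, q.Prime → q ∣ V.conductorNorm ℤ → ¬ (p : ℤ) ∣ (q : ℤ) ^ 2 - 1) ∧ ¬ p ∣ NumberField.classNumber K) ∧ (Module.finrank ℚ K = 2 ∧ NumberField.IsTotallyComplex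 K ∧ NumberField.discr K < -4 ∧ Int.gcd (NumberField.discr K) (V.conductorNorm ℤ * p) = 1) ∧ (V.conductorNorm ℤ = Nplus * Nminus ∧ Nat.Coprime Nplus Nminus ∧ Odd Nminus.primeFactors.card ∧ (∀ q : ℕ, q.Prime → q ∣ Nplus → ((Ideal.span {(q : ℤ)}).primesOver (NumberField.RingOfIntegers K)).ncard = 2) ∧ (∀ q : ℕ, q.Prime → q ∣ Nminus → ((Ideal.span {(q : ℤ)}).primesOver (NumberField.RingOfIntegers K)).ncard = 1)) ∧ (φ ≠ 0 ∧ Literature.NumberTheory.Automorphic.Brandt.eigenLattice (Nplus * Nminus) (Literature.NumberTheory.Automorphic.Brandt.matrix S.O) (fun n => V.LFunction n) = Submodule.span ℤ {φ})) → ((V.selmerCorank p : ℕ) : ℕ∞) ≤ T.acOrderOfVanishing p φ (Literature.NumberTheory.EllipticCurves.padicUnitRoot p (V.LFunction p)) := by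
  intro V _ _ p _ Nplus Nminus K _ _ S _ T φ hH
  have hlp := h1 V p Nplus Nminus K S T φ hH
  have hnc := h2 V p Nplus Nminus K S T φ hH
  have hvan : T.VanishesToOrderAc p φ (Literature.NumberTheory.EllipticCurves.padicUnitRoot p (V.LFunction p))
      (V.selmerCorank p) :=
    h3 K p Nplus Nminus S T φ (Literature.NumberTheory.EllipticCurves.padicUnitRoot p (V.LFunction p)) hnc
      (V.selmerCorank p) hlp
  exact Literature.NumberTheory.EllipticCurves.GrossPointTower.le_acOrderOfVanishing hvan

/-- THE SKELETON THEOREM (registrar shape). The crux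
`Summit.BirchSwinnertonDyer.BirchSwinnertonDyer.Theses.DefiniteTheta.DerivedHeightCap`, concluded BY NAME from the
three declared stubs through the sorry-free assembly `DerivedHeightCap_of_stubs`; the only `sorry`s in its closure
are `stub_lpCap`, `stub_normCompatible`, `stub_towerSqrt`. -/
theorem DerivedHeightCap_of :
    Summit.BirchSwinnertonDyer.BirchSwinnertonDyer.Theses.DefiniteTheta.DerivedHeightCap :=
  DerivedHeightCap_of_stubs @stub_lpCap @stub_normCompatible @stub_towerSqrt

end Summit.BirchSwinnertonDyer.BirchSwinnertonDyer.Cruxes.DerivedHeightCap.Birth
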